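import Literature.Probability.Distributions.PseudoGaussianSampler
import Literature.Analysis.SpecialFunctions.GaussianRiemannSums
import Mathlib.Analysis.SpecialFunctions.Log.Basic
import Mathlib.Analysis.Real.Pi.Bounds
import Mathlib.Analysis.Complex.ExponentialBounds
import Literature.Probability.Distributions.RoundedGaussian
import HarnessLib

/-!
# The pseudo-Gaussian sampler: estimates, and pointwise domination of the rounded Gaussian

Topic `Probability/Distributions`, sequel of `PseudoGaussianSampler.lean` (the coin-driven
block-acceptance sampler with parameters `P : PGParams` — mesh `h = 2^{-b}`, range `T = 2^{r+b}`,
acceptance granularity `q = 2^{-k}`, `J` attempts — its acceptance profile `φ`, normalising sum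
`A`, failure probability `p₀ = pNone` and exact law `ℓ' = law`, `law_eq`) and of
`RoundedGaussian.lean` (`gaussBox b j = Pr[round(2ᵇ g) = j]`, `g ∼ 𝒩(0, ½)`, `gaussBox_le`).
Written for the discharge of Aaronson–Arkhipov's Thm. 1.3
(`Literature.Computability.QuantumComplexity.gpeSolvableInFBPPRel_NPRel_of_approxBosonSamplingOracle`),
whose hiding step replaces the planted rounded-Gaussian rows of a coin-sampled matrix by sampler
rows in law; only *upper* bounds on failure probabilities are transported, so what is needed is a
ONE-SIDED pointwise comparison `ℓ_b ≤ (1 + γ) ℓ'` on the range together with the first two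
moments of `ℓ'`. All proved here (Mathlib + the two files above + `GaussianRiemannSums.lean`):

* parameters `PGParams.h`, `.q`, `.R = T h = 2^r` and the magnitude classes
  (`M_le`, `lt_M_add_one`: `(ah)²/q - 1 < M(a) ≤ (ah)²/q`);
* the acceptance profile against the Gaussian: `exp_le_phi` (`φ(a) ≥ e^{-(1+2q)(ah)²}`),
  `phi_le_exp` (`φ(a) ≤ e^{q} e^{-(ah)²}`);
* the normalising sum: `A_le` (`A ≤ e^q (1 + √π/h)`), `le_A`
  (`A ≥ (√π - 2e^{-R})/(h√(1+2q)) - 1`), `one_add_le_A` (`A ≥ 1 + 2e^{-2}/h`), whence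
  `pNone_pow_le` (`p₀^J ≤ exp(-J e^{-2}/R)`: the sampler fails only with exponentially small
  probability once `J ≫ R = 2^r`);
* the law: `sum_law` (`∑ ℓ' = 1` on `(-T, T)`), the second moment `v = ∑ (jh)² ℓ'(j)` with
  `v_le`, `v_le'` (`v ≤ ½ · e^q √(1+2q) (1+h) / (1 - (2e^{-R} + h√(1+2q))/√π)`, i.e. `v → ½`, the
  variance of `𝒩(0, ½)`, as `h, q, e^{-R} → 0`) and the crude `le_v` (`v ≥ 1/400`);
* **`gaussBox_le_mul_law`** — for `|j| < T`:
  `ℓ_b(j) ≤ e^{hR + 2qR² + q} (1 + h) / (1 - p₀^J) · ℓ'(j)`,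
  the domination factor tending to `1` when `hR, qR², q, h, p₀^J → 0`.

Numerical constants used: `√π ≥ 17/10` (`Real.pi_gt_three`), `e ≤ 68/25`, `e ≥ 13/5`
(`Real.exp_one_lt_d9`, `Real.exp_one_gt_d9`).

## References

* S. Aaronson, A. Arkhipov, *The computational complexity of linear optics*, Theory of Computing 9
  (2013) 143–252, §5.2 (proof of Thm. 1.3; p. 195: "we believe that … the hiding procedure could
  be implemented in `BPP`") and §2 (p. 161, inputs rounded to `poly(n)` bits).
-/

namespace Literature.Probability.Distributions

open Real Finset Literature.Analysis.SpecialFunctions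

namespace PGParams

variable (P : PGParams)

/-! ### Real parameters -/

/-- The mesh `h = 2^{-b}`. [folklore] -/
noncomputable def h : ℝ := ((2 : ℝ) ^ P.b)⁻¹

/-- The acceptance granularity `q = 2^{-k}`. [folklore] -/
noncomputable def q : ℝ := ((2 : ℝ) ^ P.k)⁻¹

/-- The range `R = T h = 2^r`. [folklore] -/
noncomputable def R : ℝ := (2 : ℝ) ^ P.r

/-- `h > 0`. [folklore] -/
theorem h_pos : 0 < P.h := by unfold h; positivity

/-- `h ≤ 1`. [folklore] -/
theorem h_le_one : P.h ≤ 1 := by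
  unfold h; exact inv_le_one_of_one_le₀ (one_le_pow₀ (by norm_num))

/-- `q > 0`. [folklore] -/
theorem q_pos : 0 < P.q := by unfold q; positivity

/-- `q ≤ 1/2` as soon as `k ≥ 1`. [folklore] -/
theorem q_le_half (hk : 1 ≤ P.k) : P.q ≤ 1 / 2 := by
  unfold q
  rw [one_div]
  exact inv_anti₀ (by norm_num) (by simpa using pow_le_pow_right₀ (by norm_num : (1 : ℝ) ≤ 2) hk)

/-- `T h = R`. [folklore] -/
theorem T_mul_h : (P.T : ℝ) * P.h = P.R := by
  unfold T h R
  push_cast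
  rw [pow_add, mul_assoc, mul_inv_cancel₀ (by positivity), mul_one]

/-- `1/h = 2^b` is a positive natural number. [folklore] -/
theorem h_eq_inv_natCast : P.h = ((2 ^ P.b : ℕ) : ℝ)⁻¹ := by unfold h; push_cast; rfl

/-- `q · 2^k = 1`. [folklore] -/
theorem q_mul_two_pow : P.q * (2 : ℝ) ^ P.k = 1 := by
  unfold q; exact inv_mul_cancel₀ (by positivity)

/-- **The floor in `M`**: `(a h)²/q - 1 < M(a) ≤ (a h)²/q`. [folklore] -/
theorem M_le (a : ℕ) : (P.M a : ℝ) ≤ (a * P.h) ^ 2 / P.q := by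
  unfold M h q
  have h4 : (0 : ℝ) < (4 : ℝ) ^ P.b := by positivity
  have hdiv : ((a ^ 2 * 2 ^ P.k / 4 ^ P.b : ℕ) : ℝ) ≤ (a ^ 2 * 2 ^ P.k : ℕ) / (4 ^ P.b : ℕ) :=
    Nat.cast_div_le
  refine hdiv.trans (le_of_eq ?_)
  push_cast
  have h42 : (4 : ℝ) ^ P.b = (2 : ℝ) ^ P.b * (2 : ℝ) ^ P.b := by rw [← mul_pow]; norm_num
  rw [h42]
  field_simp

/-- The other side of the floor. [folklore] -/
theorem lt_M_add_one (a : ℕ) : (a * P.h) ^ 2 / P.q < P.M a + 1 := by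
  unfold M h q
  have hlt : (a ^ 2 * 2 ^ P.k : ℕ) < (a ^ 2 * 2 ^ P.k / 4 ^ P.b) * 4 ^ P.b + 4 ^ P.b :=
    Nat.lt_div_mul_add (by positivity)
  have hltR : ((a ^ 2 * 2 ^ P.k : ℕ) : ℝ) < ((a ^ 2 * 2 ^ P.k / 4 ^ P.b : ℕ) : ℝ) * (4 : ℝ) ^ P.b +
      (4 : ℝ) ^ P.b := by exact_mod_cast hlt
  have h4 : (0 : ℝ) < (4 : ℝ) ^ P.b := by positivity
  have h42 : (4 : ℝ) ^ P.b = (2 : ℝ) ^ P.b * (2 : ℝ) ^ P.b := by rw [← mul_pow]; norm_num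
  have key : ((a : ℝ) * ((2 : ℝ) ^ P.b)⁻¹) ^ 2 / ((2 : ℝ) ^ P.k)⁻¹ =
      ((a ^ 2 * 2 ^ P.k : ℕ) : ℝ) / (4 : ℝ) ^ P.b := by
    push_cast
    rw [h42]
    field_simp
  rw [key, div_lt_iff₀ h4]
  push_cast at hltR ⊢
  linarith

/-! ### Bounds on `φ` -/

/-- **`φ(a) ≥ e^{-(1+2q)(ah)²}`** for `|a| < T` and `q ≤ 1/2`
(`log(1 - q) ≥ -q/(1-q) ≥ -q(1+2q)` and `M(a) ≤ (ah)²/q`). [folklore] -/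
theorem exp_le_phi (hk : 1 ≤ P.k) {a : ℕ} (ha : a < P.T) :
    exp (-(1 + 2 * P.q) * (a * P.h) ^ 2) ≤ P.phi a := by
  have hq := P.q_pos
  have hq2 := P.q_le_half hk
  rw [phi, Int.natAbs_natCast, if_pos ha]
  have h1q : 0 < 1 - (2 : ℝ)⁻¹ ^ P.k := by
    rw [inv_pow]; change 0 < 1 - P.q; linarith
  rw [← Real.exp_log (pow_pos h1q _), Real.log_pow, Real.exp_le_exp]
  have hlog : -(P.q * (1 + 2 * P.q)) ≤ Real.log (1 - (2 : ℝ)⁻¹ ^ P.k) := by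
    rw [inv_pow]
    change -(P.q * (1 + 2 * P.q)) ≤ Real.log (1 - P.q)
    have h := Real.one_sub_inv_le_log_of_pos (by linarith : 0 < 1 - P.q)
    have hinv : (1 - P.q)⁻¹ ≤ 1 + P.q * (1 + 2 * P.q) := by
      rw [inv_le_iff_one_le_mul₀ (by linarith)]
      nlinarith [mul_nonneg (sq_nonneg P.q) (by linarith : (0 : ℝ) ≤ 1 - 2 * P.q)]
    linarith
  have hM := P.M_le a
  calc -(1 + 2 * P.q) * (a * P.h) ^ 2 = (a * P.h) ^ 2 / P.q * (-(P.q * (1 + 2 * P.q))) := by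
        field_simp
    _ ≤ (P.M a : ℝ) * (-(P.q * (1 + 2 * P.q))) :=
        mul_le_mul_of_nonpos_right hM (by nlinarith)
    _ ≤ (P.M a : ℝ) * Real.log (1 - (2 : ℝ)⁻¹ ^ P.k) :=
        mul_le_mul_of_nonneg_left hlog (Nat.cast_nonneg _)

/-- **`φ(a) ≤ e^{-(ah)² + q}`** for every `a` (`log(1-q) ≤ -q` and `M(a) > (ah)²/q - 1`). [folklore] -/
theorem phi_le_exp (hk : 1 ≤ P.k) (a : ℕ) : P.phi a ≤ exp (-(a * P.h) ^ 2 + P.q) := by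
  have hq := P.q_pos
  have hq2 := P.q_le_half hk
  rw [phi, Int.natAbs_natCast]
  split_ifs with ha
  · have h1q : 0 < 1 - (2 : ℝ)⁻¹ ^ P.k := by
      rw [inv_pow]; change 0 < 1 - P.q; linarith
    rw [← Real.exp_log (pow_pos h1q _), Real.log_pow, Real.exp_le_exp]
    have hlog : Real.log (1 - (2 : ℝ)⁻¹ ^ P.k) ≤ -P.q := by
      rw [inv_pow]
      change Real.log (1 - P.q) ≤ -P.q
      have := Real.log_le_sub_one_of_pos (by linarith : 0 < 1 - P.q)
      linarith
    have hM := P.lt_M_add_one a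
    calc (P.M a : ℝ) * Real.log (1 - (2 : ℝ)⁻¹ ^ P.k) ≤ (P.M a : ℝ) * (-P.q) :=
          mul_le_mul_of_nonneg_left hlog (Nat.cast_nonneg _)
      _ ≤ ((a * P.h) ^ 2 / P.q - 1) * (-P.q) :=
          mul_le_mul_of_nonpos_right (by linarith) (by linarith)
      _ = -(a * P.h) ^ 2 + P.q := by field_simp; ring
  · exact (exp_pos _).le

/-! ### Bounds on the normalising sum `A` -/

/-- **`A ≤ e^q (1 + √π/h)`.** [folklore] -/
theorem A_le (hk : 1 ≤ P.k) : P.A ≤ exp P.q * (1 + √π / P.h) := by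
  have hh := P.h_pos
  have hq := P.q_pos
  have heq : 1 ≤ exp P.q := Real.one_le_exp hq.le
  rw [A_eq_one_add]
  have hsum : ∑ a ∈ Finset.Ico 1 P.T, (1 - (2 : ℝ)⁻¹ ^ P.k) ^ P.M a ≤
      exp P.q * (√π / (2 * P.h)) := by
    have hterm : ∀ a ∈ Finset.Ico 1 P.T, (1 - (2 : ℝ)⁻¹ ^ P.k) ^ P.M a ≤
        exp P.q * exp (-(P.h * ((a - 1 : ℕ) + 1)) ^ 2) := by
      intro a ha
      rw [Finset.mem_Ico] at ha
      have h := P.phi_le_exp hk a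
      rw [phi, Int.natAbs_natCast, if_pos ha.2] at h
      refine h.trans (le_of_eq ?_)
      rw [← Real.exp_add]
      congr 1
      have : ((a - 1 : ℕ) : ℝ) + 1 = a := by
        rw [Nat.cast_sub ha.1]; push_cast; ring
      rw [this]; ring
    refine (Finset.sum_le_sum hterm).trans ?_
    rw [← Finset.mul_sum]
    refine mul_le_mul_of_nonneg_left ?_ (exp_pos _).le
    have hre : ∑ a ∈ Finset.Ico 1 P.T, exp (-(P.h * ((a - 1 : ℕ) + 1)) ^ 2) =
        ∑ j ∈ Finset.range (P.T - 1), exp (-(P.h * (j + 1)) ^ 2) := by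
      rw [Finset.sum_Ico_eq_sum_range]
      refine Finset.sum_congr rfl fun j _ => ?_
      simp only [Nat.add_sub_cancel_left]
    rw [hre]
    exact sum_range_exp_neg_sq_succ_le hh _
  calc 1 + 2 * ∑ a ∈ Finset.Ico 1 P.T, (1 - (2 : ℝ)⁻¹ ^ P.k) ^ P.M a
      ≤ 1 + 2 * (exp P.q * (√π / (2 * P.h))) := by linarith
    _ = 1 + exp P.q * (√π / P.h) := by field_simp
    _ ≤ exp P.q * 1 + exp P.q * (√π / P.h) := by linarith
    _ = exp P.q * (1 + √π / P.h) := by ring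

/-- **`A ≥ (√π - 2 e^{-R})/(h √(1+2q)) - 1`** for `k ≥ 1` and `R ≥ 1`. [folklore] -/
theorem le_A (hk : 1 ≤ P.k) (hR : 1 ≤ P.R) :
    (√π - 2 * exp (-P.R)) / (P.h * √(1 + 2 * P.q)) - 1 ≤ P.A := by
  have hh := P.h_pos
  have hq := P.q_pos
  set c : ℝ := (1 + 2 * P.q) * P.h ^ 2 with hc
  have hcpos : 0 < c := by positivity
  have hsc : √c = √(1 + 2 * P.q) * P.h := by
    rw [hc, Real.sqrt_mul (by positivity), Real.sqrt_sq hh.le]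
  have hs1 : 1 ≤ √(1 + 2 * P.q) := by
    rw [Real.le_sqrt (by norm_num) (by positivity)]; nlinarith
  -- `A ≥ 2 ∑_{a<T} e^{-c a²} - 1`
  have hlow : 2 * (∑ a ∈ Finset.range P.T, exp (-c * (a : ℝ) ^ 2)) - 1 ≤ P.A := by
    rw [A_eq_one_add, Finset.range_eq_Ico, Finset.sum_eq_sum_Ico_succ_bot P.T_pos]
    simp only [CharP.cast_eq_zero, ne_eq, OfNat.ofNat_ne_zero, not_false_eq_true, zero_pow,
      mul_zero, Real.exp_zero]
    have hterm : ∀ a ∈ Finset.Ico 1 P.T, exp (-c * (a : ℝ) ^ 2) ≤ (1 - (2 : ℝ)⁻¹ ^ P.k) ^ P.M a := by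
      intro a ha
      rw [Finset.mem_Ico] at ha
      have h := P.exp_le_phi hk ha.2
      rw [phi, Int.natAbs_natCast, if_pos ha.2] at h
      refine le_trans (le_of_eq ?_) h
      rw [hc]; ring_nf
    have := Finset.sum_le_sum hterm
    linarith
  -- the Riemann lower bound
  have hL : 1 ≤ √c * P.T := by
    rw [hsc, mul_assoc, mul_comm P.h, T_mul_h]
    nlinarith
  have hrs := le_sum_range_exp_neg_mul_sq hcpos P.T hL
  have hTR : √c * P.T = √(1 + 2 * P.q) * P.R := by rw [hsc, mul_assoc, mul_comm P.h, T_mul_h]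
  rw [hTR] at hrs
  -- `e^{-√(1+2q) R} ≤ e^{-R}`
  have hexp : exp (-(√(1 + 2 * P.q) * P.R)) ≤ exp (-P.R) := by
    rw [Real.exp_le_exp]; nlinarith
  calc (√π - 2 * exp (-P.R)) / (P.h * √(1 + 2 * P.q)) - 1
      = 2 * ((√π / 2 - exp (-P.R)) / √c) - 1 := by rw [hsc]; field_simp
    _ ≤ 2 * ((√π / 2 - exp (-(√(1 + 2 * P.q) * P.R))) / √c) - 1 := by
        gcongr
    _ ≤ 2 * (∑ a ∈ Finset.range P.T, exp (-c * (a : ℝ) ^ 2)) - 1 := by linarith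
    _ ≤ P.A := hlow

/-- **Crude lower bound `A ≥ 1 + 2e^{-2}/h`** (the `1/h` magnitudes `a ≤ 1/h` each have
`φ(a) ≥ e^{-(1+2q)(ah)²} ≥ e^{-2}`), for `k ≥ 1` and `r ≥ 1`. [folklore] -/
theorem one_add_le_A (hk : 1 ≤ P.k) (hr : 1 ≤ P.r) : 1 + 2 * exp (-2) / P.h ≤ P.A := by
  have hh := P.h_pos
  have hq := P.q_pos
  have hq2 := P.q_le_half hk
  rw [A_eq_one_add]
  -- the magnitudes `1 ≤ a ≤ 2^b`
  have hsub : Finset.Icc 1 (2 ^ P.b) ⊆ Finset.Ico 1 P.T := by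
    intro a ha
    rw [Finset.mem_Icc] at ha
    rw [Finset.mem_Ico]
    refine ⟨ha.1, lt_of_le_of_lt ha.2 ?_⟩
    unfold T
    calc 2 ^ P.b < 2 ^ (P.b + 1) := Nat.pow_lt_pow_right (by norm_num) (by omega)
      _ ≤ 2 ^ (P.r + P.b) := Nat.pow_le_pow_right (by norm_num) (by omega)
  have hterm : ∀ a ∈ Finset.Icc 1 (2 ^ P.b), exp (-2) ≤ (1 - (2 : ℝ)⁻¹ ^ P.k) ^ P.M a := by
    intro a ha
    rw [Finset.mem_Icc] at ha
    have haT : a < P.T := (Finset.mem_Ico.1 (hsub (Finset.mem_Icc.2 ha))).2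
    have h := P.exp_le_phi hk haT
    rw [phi, Int.natAbs_natCast, if_pos haT] at h
    refine le_trans ?_ h
    rw [exp_le_exp]
    have hah : (a : ℝ) * P.h ≤ 1 := by
      rw [h_eq_inv_natCast, ← div_eq_mul_inv, div_le_one (by positivity)]
      exact_mod_cast ha.2
    have hah0 : 0 ≤ (a : ℝ) * P.h := by positivity
    have : ((a : ℝ) * P.h) ^ 2 ≤ 1 := by nlinarith
    nlinarith
  have hcard : ((Finset.Icc 1 (2 ^ P.b)).card : ℝ) = 1 / P.h := by
    rw [Nat.card_Icc, Nat.add_sub_cancel, h_eq_inv_natCast, one_div, inv_inv]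
  calc 1 + 2 * exp (-2) / P.h = 1 + 2 * (((Finset.Icc 1 (2 ^ P.b)).card : ℝ) * exp (-2)) := by
        rw [hcard]; ring
    _ = 1 + 2 * ∑ _a ∈ Finset.Icc 1 (2 ^ P.b), exp (-2) := by rw [Finset.sum_const, nsmul_eq_mul]
    _ ≤ 1 + 2 * ∑ a ∈ Finset.Icc 1 (2 ^ P.b), (1 - (2 : ℝ)⁻¹ ^ P.k) ^ P.M a := by
        linarith [Finset.sum_le_sum hterm]
    _ ≤ 1 + 2 * ∑ a ∈ Finset.Ico 1 P.T, (1 - (2 : ℝ)⁻¹ ^ P.k) ^ P.M a := by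
        have := Finset.sum_le_sum_of_subset_of_nonneg hsub
          (f := fun a => (1 - (2 : ℝ)⁻¹ ^ P.k) ^ P.M a) fun a _ _ => by
            apply pow_nonneg; rw [inv_pow]; change 0 ≤ 1 - P.q; linarith
        linarith

/-- **The failure probability of all `J` attempts is exponentially small**:
`p₀^J ≤ exp(-J e^{-2}/R)` (`p₀ = 1 - A/(2T) ≤ 1 - e^{-2}/R`). [folklore] -/
theorem pNone_pow_le (hk : 1 ≤ P.k) (hr : 1 ≤ P.r) :
    P.pNone ^ P.J ≤ exp (-(P.J * exp (-2) / P.R)) := by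
  have hh := P.h_pos
  have hR : 0 < P.R := by unfold R; positivity
  have hT : (0 : ℝ) < P.T := by exact_mod_cast P.T_pos
  have hA := P.one_add_le_A hk hr
  -- `A/(2T) ≥ e^{-2}/R`
  have hacc : exp (-2) / P.R ≤ P.A / (2 * P.T) := by
    rw [div_le_div_iff₀ hR (by positivity)]
    have hTh : (P.T : ℝ) = P.R / P.h := by rw [← T_mul_h]; field_simp
    rw [hTh]
    have : (1 + 2 * exp (-2) / P.h) * P.R ≤ P.A * P.R := mul_le_mul_of_nonneg_right hA hR.le
    have h2 : exp (-2) * (2 * (P.R / P.h)) = 2 * exp (-2) / P.h * P.R := by field_simp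
    rw [h2]
    nlinarith [exp_pos (-2 : ℝ), hR]
  have hp : P.pNone ≤ 1 - exp (-2) / P.R := by unfold pNone; linarith
  calc P.pNone ^ P.J ≤ (1 - exp (-2) / P.R) ^ P.J := pow_le_pow_left₀ P.pNone_nonneg hp _
    _ ≤ (exp (-(exp (-2) / P.R))) ^ P.J :=
        pow_le_pow_left₀ (by linarith [P.pNone_nonneg]) (Real.one_sub_le_exp_neg _) _
    _ = exp (-(P.J * exp (-2) / P.R)) := by rw [← Real.exp_nat_mul]; ring_nf

/-! ### The second moment of the law -/

/-- The second moment of the sampler's law in units of `h`: `v = ∑_j (j h)² ℓ'(j)`. [folklore] -/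
noncomputable def v : ℝ := ∑ j ∈ Finset.Ioo (-(P.T : ℤ)) P.T, ((j : ℝ) * P.h) ^ 2 * P.law j

/-- Folding the second moment over magnitudes: `v = 2 ∑_{a=1}^{T-1} (a h)² ℓ'(a)`. [folklore] -/
theorem v_eq_two_mul_sum : P.v = 2 * ∑ a ∈ Finset.Ico 1 P.T, ((a : ℝ) * P.h) ^ 2 * P.law a := by
  classical
  -- same decomposition of `Ioo (-T) T` as for `A`
  have hT := P.T_pos
  have hdecomp : Finset.Ioo (-(P.T : ℤ)) P.T =
      insert (0 : ℤ) (((Finset.Ico 1 P.T).image fun a : ℕ => (a : ℤ)) ∪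
        ((Finset.Ico 1 P.T).image fun a : ℕ => -(a : ℤ))) := by
    ext j
    simp only [Finset.mem_Ioo, Finset.mem_insert, Finset.mem_union, Finset.mem_image,
      Finset.mem_Ico]
    constructor
    · intro hj
      rcases lt_trichotomy j 0 with h | h | h
      · right; right; exact ⟨(-j).toNat, by omega, by omega⟩
      · left; exact h
      · right; left; exact ⟨j.toNat, by omega, by omega⟩
    · rintro (h | ⟨a, ha, rfl⟩ | ⟨a, ha, rfl⟩) <;> omega
  have hdisj : Disjoint ((Finset.Ico 1 P.T).image fun a : ℕ => (a : ℤ))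
      ((Finset.Ico 1 P.T).image fun a : ℕ => -(a : ℤ)) := by
    rw [Finset.disjoint_left]
    intro j h1 h2
    simp only [Finset.mem_image, Finset.mem_Ico] at h1 h2
    obtain ⟨a, ha, rfl⟩ := h1
    obtain ⟨b, hb, hab⟩ := h2
    omega
  have h0 : (0 : ℤ) ∉ ((Finset.Ico 1 P.T).image fun a : ℕ => (a : ℤ)) ∪
      ((Finset.Ico 1 P.T).image fun a : ℕ => -(a : ℤ)) := by
    simp only [Finset.mem_union, Finset.mem_image, Finset.mem_Ico, not_or, not_exists, not_and]
    constructor <;> intro a ha <;> omega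
  unfold v
  rw [hdecomp, Finset.sum_insert h0, Finset.sum_union hdisj,
    Finset.sum_image fun a _ b _ h => by exact_mod_cast h,
    Finset.sum_image fun a _ b _ h => by simpa using h]
  simp only [Int.cast_zero, zero_mul, ne_eq, OfNat.ofNat_ne_zero, not_false_eq_true, zero_pow,
    zero_add, Int.cast_neg, Int.cast_natCast, neg_mul, even_two, Even.neg_pow, law_neg]
  ring

/-- **`∑_{a=1}^{T-1} (ah)² φ(a) ≤ e^q (√π/(4h) + e^{-1})`** (`φ ≤ e^{q} e^{-(ah)²}` and the
second-moment Riemann sum, mesh `h = 1/2^b`). [folklore] -/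
theorem sum_sq_mul_phi_le (hk : 1 ≤ P.k) :
    ∑ a ∈ Finset.Ico 1 P.T, ((a : ℝ) * P.h) ^ 2 * P.phi a ≤
      exp P.q * (√π / (4 * P.h) + exp (-1)) := by
  have hh := P.h_pos
  have hN : 0 < 2 ^ P.b := by positivity
  have hterm : ∀ a ∈ Finset.Ico 1 P.T, ((a : ℝ) * P.h) ^ 2 * P.phi a ≤
      exp P.q * (((a : ℝ) / (2 ^ P.b : ℕ)) ^ 2 * exp (-((a : ℝ) / (2 ^ P.b : ℕ)) ^ 2)) := by
    intro a _
    have hφ := P.phi_le_exp hk a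
    have hah : (a : ℝ) * P.h = (a : ℝ) / (2 ^ P.b : ℕ) := by
      rw [h_eq_inv_natCast, div_eq_mul_inv]
    rw [hah] at hφ ⊢
    calc ((a : ℝ) / (2 ^ P.b : ℕ)) ^ 2 * P.phi a
        ≤ ((a : ℝ) / (2 ^ P.b : ℕ)) ^ 2 * exp (-((a : ℝ) / (2 ^ P.b : ℕ)) ^ 2 + P.q) :=
          mul_le_mul_of_nonneg_left hφ (sq_nonneg _)
      _ = exp P.q * (((a : ℝ) / (2 ^ P.b : ℕ)) ^ 2 * exp (-((a : ℝ) / (2 ^ P.b : ℕ)) ^ 2)) := by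
          rw [Real.exp_add]; ring
  refine (Finset.sum_le_sum hterm).trans ?_
  rw [← Finset.mul_sum]
  refine mul_le_mul_of_nonneg_left ?_ (exp_pos _).le
  have hsub : Finset.Ico 1 P.T ⊆ Finset.range P.T := by
    intro a ha; rw [Finset.mem_Ico] at ha; rw [Finset.mem_range]; exact ha.2
  refine (Finset.sum_le_sum_of_subset_of_nonneg hsub fun a _ _ => by positivity).trans ?_
  have h := sum_range_sq_mul_exp_neg_sq_le (N := 2 ^ P.b) hN P.T
  refine h.trans (le_of_eq ?_)
  rw [h_eq_inv_natCast]
  field_simp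

/-- **Upper bound on the second moment**:
`v ≤ 2 e^q (√π/(4h) + e^{-1}) / A`. [folklore] -/
theorem v_le (hk : 1 ≤ P.k) : P.v ≤ 2 * (exp P.q * (√π / (4 * P.h) + exp (-1))) / P.A := by
  have hA : 0 < P.A := lt_of_lt_of_le one_pos P.one_le_A
  rw [v_eq_two_mul_sum, mul_div_assoc]
  refine mul_le_mul_of_nonneg_left ?_ (by norm_num)
  rw [le_div_iff₀ hA, Finset.sum_mul]
  refine le_trans (Finset.sum_le_sum fun a ha => ?_) (P.sum_sq_mul_phi_le hk)
  -- `law a * A ≤ φ a` for `a ≠ 0`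
  rw [Finset.mem_Ico] at ha
  have ha0 : (a : ℤ) ≠ 0 := by exact_mod_cast (show a ≠ 0 by omega)
  rw [mul_assoc]
  refine mul_le_mul_of_nonneg_left ?_ (sq_nonneg _)
  rw [law_eq, if_neg ha0, add_zero, div_mul_eq_mul_div, mul_comm, ← mul_div_assoc,
    div_le_iff₀ hA]
  have hf : 0 ≤ P.pNone ^ P.J := pow_nonneg P.pNone_nonneg _
  have hφ := P.phi_nonneg a
  have := mul_nonneg (mul_nonneg hA.le hφ) hf
  nlinarith

/-- Numerical constants: `√π ≥ 17/10` and `exp 1 ≤ 68/25`. [folklore] -/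
theorem sqrt_pi_ge : (17 / 10 : ℝ) ≤ √π := by
  rw [Real.le_sqrt (by norm_num) Real.pi_pos.le]
  nlinarith [Real.pi_gt_three]

/-- `exp 1 ≤ 2.72`. [folklore] -/
theorem exp_one_le : exp 1 ≤ (68 / 25 : ℝ) := by
  have := Real.exp_one_lt_d9; norm_num at this ⊢; linarith

/-- **The second moment in parameters**: for `k ≥ 1`, `r ≥ 1`,
`v ≤ (1/2) · e^q √(1+2q) (1 + h) / (1 - (2 e^{-R} + h √(1+2q))/√π)`, provided the denominator is
positive. [folklore] -/
theorem v_le' (hk : 1 ≤ P.k) (hR : 1 ≤ P.R)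
    (hden : 0 < 1 - (2 * exp (-P.R) + P.h * √(1 + 2 * P.q)) / √π) :
    P.v ≤ 1 / 2 * (exp P.q * √(1 + 2 * P.q) * (1 + P.h)) /
      (1 - (2 * exp (-P.R) + P.h * √(1 + 2 * P.q)) / √π) := by
  have hh := P.h_pos
  have hq := P.q_pos
  have hπ : 0 < √π := Real.sqrt_pos.2 Real.pi_pos
  have hπ' := sqrt_pi_ge
  have hs : 1 ≤ √(1 + 2 * P.q) := by
    rw [Real.le_sqrt (by norm_num) (by positivity)]; nlinarith
  have hA := P.le_A hk hR
  -- `A ≥ (√π/h) D / √(1+2q)` with `D` the denominator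
  set D : ℝ := 1 - (2 * exp (-P.R) + P.h * √(1 + 2 * P.q)) / √π with hD
  have hAD : √π * D / (P.h * √(1 + 2 * P.q)) ≤ P.A := by
    refine le_trans (le_of_eq ?_) hA
    rw [hD]
    field_simp
    ring
  have hADpos : 0 < √π * D / (P.h * √(1 + 2 * P.q)) := by positivity
  have hApos : 0 < P.A := lt_of_lt_of_le one_pos P.one_le_A
  have hv := P.v_le hk
  -- replace `A` by its lower bound
  have hv2 : P.v ≤ 2 * (exp P.q * (√π / (4 * P.h) + exp (-1))) /
      (√π * D / (P.h * √(1 + 2 * P.q))) := by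
    refine hv.trans ?_
    apply div_le_div_of_nonneg_left (by positivity) hADpos hAD
  refine hv2.trans ?_
  -- `(√π/(4h) + e^{-1}) ≤ (√π/(4h)) (1 + h)` since `4 e^{-1} ≤ √π`
  have he : 4 * exp (-1) ≤ √π := by
    rw [Real.exp_neg]
    have h3 : (exp 1)⁻¹ ≤ (5 / 13 : ℝ) := by
      rw [inv_le_comm₀ (exp_pos 1) (by norm_num)]
      have := Real.exp_one_gt_d9; norm_num at this ⊢; linarith
    linarith
  have key : 2 * (exp P.q * (√π / (4 * P.h) + exp (-1))) / (√π * D / (P.h * √(1 + 2 * P.q))) =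
      1 / 2 * (exp P.q * √(1 + 2 * P.q) * (1 + 4 * exp (-1) * P.h / √π)) / D := by
    field_simp
    ring
  rw [key]
  apply div_le_div_of_nonneg_right _ hden.le
  apply mul_le_mul_of_nonneg_left _ (by norm_num)
  apply mul_le_mul_of_nonneg_left _ (by positivity)
  have : 4 * exp (-1) * P.h / √π ≤ P.h := by
    rw [div_le_iff₀ hπ]
    nlinarith [exp_pos (-1 : ℝ)]
  linarith

/-- **The law is a probability law on `(-T, T)`**: `∑_{|j|<T} ℓ'(j) = 1`
(`∑ φ = A` and the default value `0` carries the mass `p₀^J`). [folklore] -/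
theorem sum_law : ∑ j ∈ Finset.Ioo (-(P.T : ℤ)) P.T, P.law j = 1 := by
  have hA : 0 < P.A := lt_of_lt_of_le one_pos P.one_le_A
  have hT := P.T_pos
  simp_rw [law_eq]
  rw [Finset.sum_add_distrib, Finset.sum_ite_eq', ← Finset.sum_mul, ← Finset.sum_div,
    show ∑ j ∈ Finset.Ioo (-(P.T : ℤ)) P.T, P.phi j = P.A from rfl, div_self hA.ne', one_mul,
    if_pos (by simp only [Finset.mem_Ioo]; omega)]
  ring

/-- **Crude lower bound on the second moment**: `v ≥ 1/400` for `b ≥ 1`, `k ≥ 1` and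
`p₀^J ≤ 1/2` (the `2^{b-1}` magnitudes `a ∈ [2^{b-1}, 2^b)` have `(ah)² ≥ 1/4` and
`ℓ'(a) ≥ (1 - p₀^J) φ(a)/A ≥ e^{-2}/(2A)`, while `A ≤ e^q (1 + √π/h) ≤ 6/h`). [folklore] -/
theorem le_v (hb : 1 ≤ P.b) (hk : 1 ≤ P.k) (hJ : P.pNone ^ P.J ≤ 1 / 2) : 1 / 400 ≤ P.v := by
  have hh := P.h_pos
  have hh1 := P.h_le_one
  have hq := P.q_pos
  have hq2 := P.q_le_half hk
  have hA1 := P.one_le_A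
  have hApos : 0 < P.A := by linarith
  have h2b : (2 : ℝ) ^ P.b = 2 * 2 ^ (P.b - 1) := by
    rw [← pow_succ']; congr 1; omega
  -- `A ≤ 6/h`
  have hA : P.A ≤ 6 / P.h := by
    refine (P.A_le hk).trans ?_
    have he : exp P.q ≤ 2 := by
      refine (Real.exp_bound_div_one_sub_of_interval hq.le (by linarith)).trans ?_
      rw [div_le_iff₀ (by linarith)]; linarith
    have hπ : √π ≤ 2 := by
      rw [Real.sqrt_le_iff]; constructor
      · norm_num
      · nlinarith [Real.pi_le_four]
    have h1h : 1 ≤ 1 / P.h := by rw [le_div_iff₀ hh]; linarith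
    have hsum : 1 + √π / P.h ≤ 3 / P.h := by
      have : √π / P.h ≤ 2 / P.h := div_le_div_of_nonneg_right hπ hh.le
      have h3 : 3 / P.h = 1 / P.h + 2 / P.h := by ring
      linarith
    calc exp P.q * (1 + √π / P.h) ≤ 2 * (3 / P.h) :=
          mul_le_mul he hsum (by positivity) (by norm_num)
      _ = 6 / P.h := by ring
  -- the magnitudes `a ∈ [2^{b-1}, 2^b)`
  set S : Finset ℕ := Finset.Ico (2 ^ (P.b - 1)) (2 ^ P.b) with hS_def
  have hsub : S ⊆ Finset.Ico 1 P.T := by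
    intro a ha
    rw [hS_def, Finset.mem_Ico] at ha
    rw [Finset.mem_Ico]
    refine ⟨le_trans Nat.one_le_two_pow ha.1, lt_of_lt_of_le ha.2 ?_⟩
    unfold T
    exact Nat.pow_le_pow_right (by norm_num) (by omega)
  have hterm : ∀ a : ℕ, a ∈ S →
      (1 / 4 : ℝ) * (exp (-2) / (6 / P.h) * (1 / 2)) ≤ ((a : ℝ) * P.h) ^ 2 * P.law a := by
    intro a ha
    have haT : a < P.T := (Finset.mem_Ico.1 (hsub ha)).2
    rw [hS_def, Finset.mem_Ico] at ha
    have hah : 1 / 2 ≤ (a : ℝ) * P.h := by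
      have h2a : (2 : ℝ) ^ P.b ≤ 2 * a := by
        have : (2 : ℝ) ^ (P.b - 1) ≤ a := by exact_mod_cast ha.1
        linarith
      unfold h
      rw [le_mul_inv_iff₀ (by positivity)]
      linarith
    have hah1 : (a : ℝ) * P.h ≤ 1 := by
      unfold h
      rw [mul_inv_le_iff₀ (by positivity), one_mul]
      exact_mod_cast ha.2.le
    have ha0 : 0 ≤ (a : ℝ) * P.h := by positivity
    have hφ : exp (-2) ≤ P.phi a := by
      refine le_trans ?_ (P.exp_le_phi hk haT)
      rw [Real.exp_le_exp]
      have : (1 + 2 * P.q) * ((a : ℝ) * P.h) ^ 2 ≤ 2 * 1 :=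
        mul_le_mul (by linarith) (by nlinarith) (sq_nonneg _) (by norm_num)
      linarith
    have hlaw : exp (-2) / (6 / P.h) * (1 / 2) ≤ P.law a := by
      refine le_trans ?_ (P.phi_div_mul_le_law a)
      apply mul_le_mul _ (by linarith) (by norm_num) (div_nonneg (P.phi_nonneg _) hApos.le)
      calc exp (-2) / (6 / P.h) ≤ exp (-2) / P.A :=
            div_le_div_of_nonneg_left (exp_pos _).le hApos hA
        _ ≤ P.phi a / P.A := div_le_div_of_nonneg_right hφ hApos.le
    calc (1 / 4 : ℝ) * (exp (-2) / (6 / P.h) * (1 / 2))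
        ≤ ((a : ℝ) * P.h) ^ 2 * (exp (-2) / (6 / P.h) * (1 / 2)) := by
          apply mul_le_mul_of_nonneg_right _ (by positivity)
          nlinarith
      _ ≤ ((a : ℝ) * P.h) ^ 2 * P.law a := mul_le_mul_of_nonneg_left hlaw (sq_nonneg _)
  have hcard : (S.card : ℝ) = (2 : ℝ) ^ (P.b - 1) := by
    rw [hS_def, Nat.card_Ico]
    have h2 : 2 ^ P.b = 2 * 2 ^ (P.b - 1) := by rw [← pow_succ']; congr 1; omega
    rw [show 2 ^ P.b - 2 ^ (P.b - 1) = 2 ^ (P.b - 1) by omega]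
    push_cast; ring
  have hS : (S.card : ℝ) * ((1 / 4 : ℝ) * (exp (-2) / (6 / P.h) * (1 / 2))) ≤
      ∑ a ∈ Finset.Ico 1 P.T, ((a : ℝ) * P.h) ^ 2 * P.law a := by
    calc _ = ∑ a ∈ S, ((1 / 4 : ℝ) * (exp (-2) / (6 / P.h) * (1 / 2))) := by
          rw [Finset.sum_const, nsmul_eq_mul]
      _ ≤ ∑ a ∈ S, ((a : ℝ) * P.h) ^ 2 * P.law a := Finset.sum_le_sum hterm
      _ ≤ _ := Finset.sum_le_sum_of_subset_of_nonneg hsub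
          (fun a _ _ => mul_nonneg (sq_nonneg _) (P.law_nonneg _))
  rw [hcard] at hS
  have hhalf : (2 : ℝ) ^ (P.b - 1) * P.h = 1 / 2 := by
    unfold h
    rw [h2b, mul_inv, ← mul_assoc, mul_comm ((2 : ℝ) ^ (P.b - 1)), mul_assoc,
      mul_inv_cancel₀ (by positivity)]
    norm_num
  have he2 : (1 / 8 : ℝ) ≤ exp (-2) := by
    rw [Real.exp_neg, le_inv_comm₀ (by norm_num) (exp_pos _)]
    have h1 := Real.exp_one_lt_d9
    have h2 : exp 2 = exp 1 * exp 1 := by rw [← Real.exp_add]; norm_num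
    rw [h2]
    norm_num at h1 ⊢
    nlinarith [exp_pos (1 : ℝ)]
  have hre : (2 : ℝ) ^ (P.b - 1) * (1 / 4 * (exp (-2) / (6 / P.h) * (1 / 2))) =
      (2 : ℝ) ^ (P.b - 1) * P.h * exp (-2) / 48 := by
    field_simp
    norm_num
  rw [hre, hhalf] at hS
  rw [v_eq_two_mul_sum]
  linarith

/-! ### Pointwise domination of the rounded Gaussian by the sampler's law -/

/-- `φ` and the law depend on `|j|` only. [folklore] -/
theorem phi_natAbs (j : ℤ) : P.phi (j.natAbs : ℤ) = P.phi j := by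
  simp [phi, Int.natAbs_abs]

/-- The law depends on `|j|` only. [folklore] -/
theorem law_natAbs (j : ℤ) : P.law (j.natAbs : ℤ) = P.law j := by
  rcases Int.natAbs_eq j with h | h
  · rw [← h]
  · conv_rhs => rw [h]
    rw [law_neg]

/-- **The rounded Gaussian is dominated by the sampler's law, pointwise on the range**: for
`|j| < T`, `k ≥ 1`, `r ≥ 1`,
`ℓ_b(j) ≤ e^{hR + 2qR² + q} (1 + h) / (1 - p₀^J) · ℓ'(j)` —
`ℓ_b(j) ≤ (h/√π) e^{-(jh)²} e^{h²|j|}` (`gaussBox_le`), `ℓ'(j) ≥ (1 - p₀^J) φ(j)/A`,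
`φ(j) ≥ e^{-(1+2q)(jh)²}`, `A ≤ e^q(1 + √π/h)`, and `h²|j| ≤ hR`, `2q(jh)² ≤ 2qR²`. [folklore] -/
theorem gaussBox_le_mul_law (hk : 1 ≤ P.k) (hJ : P.pNone ^ P.J < 1) {j : ℤ}
    (hj : j.natAbs < P.T) :
    gaussBox P.b j ≤ exp (P.h * P.R + 2 * P.q * P.R ^ 2 + P.q) * (1 + P.h) / (1 - P.pNone ^ P.J) *
      P.law j := by
  have hh := P.h_pos
  have hq := P.q_pos
  have hπ : 0 < √π := Real.sqrt_pos.2 Real.pi_pos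
  have hπ1 : 1 ≤ √π := by
    rw [Real.le_sqrt (by norm_num) Real.pi_pos.le]; linarith [Real.pi_gt_three]
  have hf : 0 < 1 - P.pNone ^ P.J := by linarith
  have hA : 0 < P.A := lt_of_lt_of_le one_pos P.one_le_A
  set a : ℕ := j.natAbs with ha
  -- the magnitude in units of `h`, and its size
  have haR : (a : ℝ) * P.h ≤ P.R := by
    rw [← T_mul_h]
    exact mul_le_mul_of_nonneg_right (by exact_mod_cast hj.le) hh.le
  have ha0 : 0 ≤ (a : ℝ) * P.h := by positivity
  -- (1) the Gaussian side
  have hG : gaussBox P.b j ≤ P.h / √π * (exp (-((a : ℝ) * P.h) ^ 2) * exp (P.h * P.R)) := by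
    have h1 := gaussBox_le P.b j
    have hcast : ((j : ℝ) ^ 2 - |(j : ℝ)|) = (a : ℝ) ^ 2 - a := by
      rw [ha, Nat.cast_natAbs, Int.cast_abs, sq_abs]
    rw [hcast] at h1
    refine h1.trans ?_
    change P.h / √π * exp (-(P.h ^ 2 * ((a : ℝ) ^ 2 - a))) ≤ _
    refine mul_le_mul_of_nonneg_left ?_ (by positivity)
    rw [← Real.exp_add, Real.exp_le_exp]
    have : P.h ^ 2 * (a : ℝ) ≤ P.h * P.R := by nlinarith
    nlinarith
  -- (2) the sampler side
  have hL : (1 - P.pNone ^ P.J) * (exp (-(1 + 2 * P.q) * ((a : ℝ) * P.h) ^ 2) /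
      (exp P.q * (1 + √π / P.h))) ≤ P.law j := by
    rw [← law_natAbs, ← ha]
    refine le_trans ?_ (P.phi_div_mul_le_law a)
    rw [mul_comm]
    refine mul_le_mul_of_nonneg_right ?_ hf.le
    have hφ := P.exp_le_phi hk hj
    have hAle := P.A_le hk
    calc exp (-(1 + 2 * P.q) * ((a : ℝ) * P.h) ^ 2) / (exp P.q * (1 + √π / P.h))
        ≤ exp (-(1 + 2 * P.q) * ((a : ℝ) * P.h) ^ 2) / P.A :=
          div_le_div_of_nonneg_left (exp_pos _).le hA hAle
      _ ≤ P.phi a / P.A := div_le_div_of_nonneg_right hφ hA.le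
  -- (3) combine: `gaussBox ≤ factor * lower bound ≤ factor * law`
  have hfac : 0 ≤ exp (P.h * P.R + 2 * P.q * P.R ^ 2 + P.q) * (1 + P.h) / (1 - P.pNone ^ P.J) := by
    positivity
  refine le_trans ?_ (mul_le_mul_of_nonneg_left hL hfac)
  refine hG.trans ?_
  -- the algebra: everything is a product of exponentials and positive factors
  have h2q : exp (-(1 + 2 * P.q) * ((a : ℝ) * P.h) ^ 2) =
      exp (-((a : ℝ) * P.h) ^ 2) * exp (-(2 * P.q * ((a : ℝ) * P.h) ^ 2)) := by
    rw [← Real.exp_add]; ring_nf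
  have hkey : exp (P.h * P.R + 2 * P.q * P.R ^ 2 + P.q) * (1 + P.h) / (1 - P.pNone ^ P.J) *
      ((1 - P.pNone ^ P.J) * (exp (-(1 + 2 * P.q) * ((a : ℝ) * P.h) ^ 2) /
        (exp P.q * (1 + √π / P.h)))) =
      P.h / √π * (exp (-((a : ℝ) * P.h) ^ 2) * exp (P.h * P.R)) *
        (exp (2 * P.q * P.R ^ 2) * exp (-(2 * P.q * ((a : ℝ) * P.h) ^ 2)) *
          ((1 + P.h) / (1 + P.h / √π))) := by
    rw [h2q]
    have hsplit : exp (P.h * P.R + 2 * P.q * P.R ^ 2 + P.q) =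
        exp (P.h * P.R) * exp (2 * P.q * P.R ^ 2) * exp P.q := by
      rw [← Real.exp_add, ← Real.exp_add]
    rw [hsplit]
    field_simp
    ring
  rw [hkey]
  -- the last factor is `≥ 1`
  have hlast : 1 ≤ exp (2 * P.q * P.R ^ 2) * exp (-(2 * P.q * ((a : ℝ) * P.h) ^ 2)) *
      ((1 + P.h) / (1 + P.h / √π)) := by
    have he : 1 ≤ exp (2 * P.q * P.R ^ 2) * exp (-(2 * P.q * ((a : ℝ) * P.h) ^ 2)) := by
      rw [← Real.exp_add]
      apply Real.one_le_exp
      have : ((a : ℝ) * P.h) ^ 2 ≤ P.R ^ 2 := pow_le_pow_left₀ ha0 haR 2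
      nlinarith
    have hr : 1 ≤ (1 + P.h) / (1 + P.h / √π) := by
      rw [one_le_div (by positivity)]
      have : P.h / √π ≤ P.h := div_le_self hh.le hπ1
      linarith
    nlinarith
  have hbase : 0 ≤ P.h / √π * (exp (-((a : ℝ) * P.h) ^ 2) * exp (P.h * P.R)) := by positivity
  nlinarith

end PGParams

end Literature.Probability.Distributions
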